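import Mathlib
import Literature.NumberTheory.LFunctions.Zhang2022.Section4Lemma45FromLemma44
import Literature.NumberTheory.LFunctions.Zhang2022.SkeletonDed22R
import Literature.NumberTheory.LFunctions.Zhang2022.Section4Lemma43Edge
import HarnessLib

/-!
# Zhang (2022), §4 Lemma 4.5 on the CLOSED range `1/2 + α² ≤ σ < 1` (`Skeleton.Lemma45C`)

Topic `Literature/NumberTheory/LFunctions/Zhang2022` (Landau–Siegel audit tree; verdict-neutral).
Y. Zhang, *Discrete mean estimates and the Landau–Siegel zero*, arXiv:2211.02515v1 (2022)
[Zhang2022LandauSiegel] — **an unrefereed manuscript under adjudication**. The STATEMENT of Lemma 4.5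
(§4 p. 21) has the open range `1/2 + α² < σ < 1`, but its PROOF ("Case 2. `1/2 + α² ≤ σ < 1/2 + 𝓛⁻¹`",
tex L1178) covers the closed range; the skeleton's reading of record for the deduction of Prop. 2.2
(`SkeletonDed22R`, `Ded22R`) consumes the closed form `Skeleton.Lemma45C` (this closes the seam at
`σ = 1/2 + α²` between Lemmas 4.5 and 4.6). Theorem-only, no new definitions, no new facts:

* `dedLem45C : Eq410 → Step4u044 → Step4u046Alpha → Lemma45C` — the proof block of Lemma 4.5 run on
  the closed range (L1-t7's typed Case-2 display `Step4u046Alpha` is already over the closed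
  `case2Region45`; Case 1 is `Step4u044`, kernel theorem of its inputs in `Section4Lemma45Edge`):
  Case 2 gives `|𝒜(s)| ≥ cα > 0`; Case 1 gives `|ℬ(s)| ≤ CP^{1/2−σ} ≤ Ce^{−𝓛⁸} ≤ 1/4` and
  `|𝒜 − 1 − ℬ| ≤ C′𝓛⁻¹⁰⁰ ≤ 1/2` by (4.10), so `|𝒜(s)| ≥ 1/4`;
* `lemma45C_of_inputs : Lemma41 → Lemma42 → Lemma43 → Eq45 → Eq46 → Eq410 → Lemma45C`;
* `lemma45C_of_lemma43_44 : Lemma43 → Lemma44 → Lemma45C` — with the tree's `lemma41_holds`,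
  `lemma42_holds`, `eq45_holds`, `eq46_holds`, `eq410_of` (as in `Section4Lemma45FromLemma44`);
* (appended) `lemma45_of_lemma44 : Lemma44 → Lemma45`, `lemma45C_of_lemma44 : Lemma44 → Lemma45C` —
  with d15's `Skeleton.lemma43_of`: **Lemma 4.5 follows from Lemma 4.4 alone.**

What is NOT asserted: Lemma 4.4 (CLAIM node), hence not Lemma 4.5 / `Lemma45C` as such;
anything about Theorems 1–2 of the source or about Landau–Siegel zeros; nothing here bears on the
cell's verdict on (8.24).

## References

* Y. Zhang, arXiv:2211.02515v1 (2022), §4 Lemma 4.5 and its proof, pp. 21–22 (tex L1153–L1194).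
  [cite: Zhang2022LandauSiegel, Lemma 4.5 pp.21–22]
-/

noncomputable section

open Complex Real

namespace Literature.NumberTheory.LFunctions.Zhang2022.Section4

open Literature.NumberTheory.LFunctions.Zhang2022.Skeleton

variable {D : ℕ}

/-- `B ≤ 𝓛` once `D ≥ ⌈exp B⌉` ("`D` sufficiently large", §2 p.4). [cite: Zhang2022LandauSiegel, §2 p. 4] -/
private theorem le_ell_of_ceil_exp_le' {B : ℝ} (hD : ⌈Real.exp B⌉₊ ≤ D) : B ≤ ell D := by
  have h1 : Real.exp B ≤ D := le_trans (Nat.le_ceil _) (by exact_mod_cast hD)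
  have hDpos : (0 : ℝ) < D := lt_of_lt_of_le (Real.exp_pos _) h1
  rw [ell, Real.le_log_iff_exp_le hDpos]
  exact h1

/-- If `2·max(C,0) + 1 ≤ 𝓛` then `C·𝓛⁻ᵏ ≤ 1/2` for `k ≥ 1`. [cite: Zhang2022LandauSiegel, §2 p. 4] -/
private theorem const_mul_inv_pow_le_half' {C ℓ : ℝ} {k : ℕ} (hk : k ≠ 0)
    (hℓ : 2 * max C 0 + 1 ≤ ℓ) : C * (ℓ ^ k)⁻¹ ≤ 1 / 2 := by
  have hC := le_max_right C 0
  have hℓ1 : 1 ≤ ℓ := by linarith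
  have hpow : ℓ ≤ ℓ ^ k := le_self_pow₀ hℓ1 hk
  have hpos : 0 < ℓ ^ k := by positivity
  rw [← div_eq_mul_inv, div_le_iff₀ hpos]
  linarith [le_max_left C 0]

/-- Eventual smallness for the Case-1 endgame: `C⁺·e^{−𝓛⁸} ≤ 1/4` once `𝓛 ≥ 4C⁺`, `𝓛 ≥ 1` ("The
result now follows by (4.10)", Lemma 4.5 Case 1). [cite: Zhang2022LandauSiegel, Lemma 4.5 (proof, Case 1) p.21] -/
private theorem case1_endgame_small {C ℓ : ℝ} (hℓ1 : 1 ≤ ℓ) (hℓ : 4 * max C 0 ≤ ℓ) :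
    max C 0 * Real.exp (-ℓ ^ 8) ≤ 1 / 4 := by
  have h8 : ℓ ≤ ℓ ^ 8 := le_self_pow₀ hℓ1 (by norm_num)
  have hexp : Real.exp (-ℓ ^ 8) ≤ (1 + ℓ ^ 8)⁻¹ := by
    rw [Real.exp_neg]
    exact inv_anti₀ (by positivity) (by linarith [Real.add_one_le_exp (ℓ ^ 8)])
  calc max C 0 * Real.exp (-ℓ ^ 8) ≤ max C 0 * (1 + ℓ ^ 8)⁻¹ := by
        gcongr
    _ ≤ 1 / 4 := by
        rw [← div_eq_mul_inv, div_le_iff₀ (by positivity)]; linarith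

/-- **The proof block of Lemma 4.5 run on the CLOSED range**: (4.10), Case 1's "`ℬ(s,ψ) ≪ P^{1/2−σ}`"
(`Step4u044`, over `1/2 + 𝓛⁻¹ ≤ σ < 1`) and Case 2's "`|𝒜(s,ψ)| ≫ α`" (`Step4u046Alpha`, over the
closed `1/2 + α² ≤ σ < 1/2 + 𝓛⁻¹`) give `𝒜(s,ψ) ≠ 0` for `1/2 + α² ≤ σ < 1`, `|t − 2πt₀| < 𝓛₁ + 2`.
[cite: Zhang2022LandauSiegel, Lemma 4.5 (proof) pp.21–22] -/
theorem dedLem45C (h410 : Eq410) (h44 : Step4u044) (h46a : Step4u046Alpha) : Lemma45C := by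
  obtain ⟨C₀, h410⟩ := h410
  obtain ⟨C₄, h44⟩ := h44
  obtain ⟨c, hc, h46a⟩ := h46a
  obtain ⟨D₀, h⟩ := (h410.and h44).and h46a
  refine ⟨max D₀ (max 3 ⌈Real.exp (max (2 * max C₀ 0 + 1) (4 * max C₄ 0))⌉₊),
    fun D _ χ hD hq hp x hx s h1 h2 h3 => ?_⟩
  have hD₀ : D₀ ≤ D := le_trans (le_max_left _ _) hD
  have hD3 : 3 ≤ D := le_trans (le_trans (le_max_left _ _) (le_max_right _ _)) hD
  have hB' := le_ell_of_ceil_exp_le' (le_trans (le_trans (le_max_right _ _) (le_max_right _ _)) hD)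
  have hℓ0 : 2 * max C₀ 0 + 1 ≤ ell D := le_trans (le_max_left _ _) hB'
  have hℓ4 : 4 * max C₄ 0 ≤ ell D := le_trans (le_max_right _ _) hB'
  have hℓ1 : 1 ≤ ell D := (one_lt_ell hD3).le
  have hα : 0 < alpha D := by
    rw [alpha, bigP, Real.log_exp]
    exact div_pos Real.pi_pos (pow_pos (by linarith [one_lt_ell hD3]) _)
  obtain ⟨⟨e410, e44⟩, e46a⟩ := h D χ hD₀ hq hp
  by_cases hσ : s.re < 1 / 2 + (ell D)⁻¹
  · exact norm_pos_iff.mp (lt_of_lt_of_le (mul_pos hc hα) (e46a x hx s ⟨h1, hσ, h3⟩))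
  · push Not at hσ
    have hP0 : 0 ≤ bigP D ^ (1 / 2 - s.re) := Real.rpow_nonneg (Real.exp_pos _).le _
    have hB : ‖calB χ x s‖ ≤ 1 / 4 :=
      calc ‖calB χ x s‖ ≤ C₄ * bigP D ^ (1 / 2 - s.re) := e44 x hx s ⟨hσ, h2, h3⟩
        _ ≤ max C₄ 0 * bigP D ^ (1 / 2 - s.re) :=
            mul_le_mul_of_nonneg_right (le_max_left _ _) hP0
        _ ≤ max C₄ 0 * Real.exp (-ell D ^ 8) :=
            mul_le_mul_of_nonneg_left (bigP_rpow_le_exp_neg hD3 hσ) (le_max_right _ _)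
        _ ≤ 1 / 4 := case1_endgame_small hℓ1 hℓ4
    have hE : C₀ * (ell D ^ 100)⁻¹ ≤ 1 / 2 := const_mul_inv_pow_le_half' (by norm_num) hℓ0
    have hΩ3 : s ∈ Omega3 D := ⟨by nlinarith [sq_nonneg (alpha D)], by linarith, by linarith⟩
    have hA := Lemma45.norm_calA_ge (e410 x hx s hΩ3) hB
    exact norm_pos_iff.mp (by linarith)

/-- **`Lemma45C` from the typed inputs of Lemma 4.5's proof**: Case 1 (`Section4Lemma45Edge`) and
L1-t7's Case-2 chain `eq411_of`, `step4u045_of`, `step4u046_of`, `step4u046Alpha_of`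
(`TypedSection04C`). [cite: Zhang2022LandauSiegel, Lemma 4.5 (proof) pp.21–22] -/
theorem lemma45C_of_inputs (h41 : Lemma41) (h42 : Lemma42) (h43 : Lemma43) (h45 : Eq45) (h46 : Eq46)
    (h410 : Eq410) : Lemma45C :=
  dedLem45C h410 (step4u044_of_step4u043_eq45 (step4u043_of_lemma41_42 h41 h42) h45)
    (step4u046Alpha_of (step4u046_of h410 (step4u045_of h42 (eq411_of h42 h43 h46))))

/-- **`Lemma45C` from Lemma 4.3 and Lemma 4.4** (tree theorems `lemma41_holds`, `lemma42_holds`,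
`eq45_holds`, `eq46_holds`, edge `eq410_of`). [cite: Zhang2022LandauSiegel, Lemma 4.5 pp.21–22] -/
theorem lemma45C_of_lemma43_44 (h43 : Lemma43) (h44 : Lemma44) : Lemma45C :=
  lemma45C_of_inputs lemma41_holds lemma42_holds h43 eq45_holds eq46_holds
    (eq410_of lemma41_holds lemma42_holds h44)

/-! ## Lemma 4.5 from Lemma 4.4 alone (appended once `Section4Lemma43Edge` became co-importable) -/

/-- **Lemma 4.5 from Lemma 4.4 (the approximate functional equation) alone**: Lemma 4.3 follows from
Lemmas 4.1–4.2 by d15's kernel edge `Skeleton.lemma43_of` (`Section4Lemma43Edge`), and Lemmas 4.1, 4.2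
are tree theorems; so cone leaf C07 (`Skeleton.Lemma45`) reduces to the single CLAIM node `Lemma44`.
[cite: Zhang2022LandauSiegel, Lemma 4.5 pp.21–22] -/
theorem lemma45_of_lemma44 (h44 : Lemma44) : Lemma45 :=
  lemma45_of_lemma43_44 (lemma43_of lemma41_holds lemma42_holds) h44

/-- The same for the closed-range form consumed by `Skeleton.Ded22R`: **`Lemma44 → Lemma45C`**.
[cite: Zhang2022LandauSiegel, Lemma 4.5 pp.21–22] -/
theorem lemma45C_of_lemma44 (h44 : Lemma44) : Lemma45C :=
  lemma45C_of_lemma43_44 (lemma43_of lemma41_holds lemma42_holds) h44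

end Literature.NumberTheory.LFunctions.Zhang2022.Section4
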